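import Summits.AtomisticToContinuum.Crystallization.Theorems.OverbindingBudgetAffineRunCutStarKernel
import Summits.AtomisticToContinuum.Crystallization.Theorems.OverbindingBudgetAffineRunCutBondLink

/-!
# `OverbindingBudget` / crux `RobustDefectLimitWindows` (stmt-AtomisticToContinuum-31280) — «RunCut» part 23B-α «BONDCARRY»:
# ONE BOND OF A LEG CARRIES A STAR LINE AT CHORD COST `33/10⁵`

Support file (lens-4 g90; order of record (2c), `ρ₁ = 30`; memo `g90/memo/STARKERNEL-g90.md` §2 = the recipe typed here; plan of record
`g89/POINTERS-g90.md` §6f (architecture (i) current-model carry) + critic row 1621 (D)).  This is where the two halves of part 23A meet: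
the COMBINATORIAL half `…RunCutStarKernel` (which child star member the exact bond dictionary `R₁` pulls back onto the carried parent member,
and its face / zero-sum-quad label representation) and the ANALYTIC half `…RunCutBondLink` (registration-sourced link bounds, lower norms,
the sharp chord constant).  SOURCE of every constant: `hf` (registrations `10⁻⁴ ν`), the scale window `0.9967 ≤ ν_k/ν_p ≤ 1.0011` and the exact
dictionary of `…CompressedCutEstablish.bond_exact`, `hA` only through `‖A x − Q x‖ ≤ 2·10⁻³` on star vectors (`‖x‖² = 8/3`).
* §1 Euclidean glue: normalising a positively scaled vector, the model axis `(1/3)·mv(12,12,12) = (√18)⁻¹·(4,4,4)` (the engine's `N`), the model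
  cosine `±1/3` of a side member against the axis, and its physical reading `|cos| ≤ 1/3 + 246/10⁵` through ONE frame (`side_cos_le`: two chords
  `(2/1000)/(16309/10⁴)` — the anchor constant is `246/10⁵`, one unit above the memo's `245/10⁵`, which used `‖Q x‖` instead of the lower norm).
* §2 ★★ `bond_carry` (section `Atlas`, ONE chart datum on `B(y j, ρ₁ ν_j)` verbatim as in parts 22A–22D): a site `p` listed by `Cp`, a first-shell
  label `x` registering `k`, a carried member `X ∈ XP` with the kernel table / representation table / own-face tables as hypotheses ⇒ `k ≠ p`, the
  scale window, and a child member `Y ∈ XS` with `‖unit(A_k((1/3)mv Y)) − unit(A_p((1/3)mv X))‖ ≤ 33/10⁵`.  Assembly: `bond_exact` → `chartDict_of_exactDict id`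
  → `star_step_one` (`R₁ (mv Y) = mv X`) → `rep_table` entry → `face_real_of_faceRepB` / `quad_real_of_quadRepB` + the `ExactDict` partners +
  injectivity of `R₁` (child-side identity) → `face_link`/`quad_link` + `_record` → own-face lower norms (`near_isometry_combo3`, `norm_face_lower_scaled`)
  → `kappa_face`.
* §3 ★ `carry_step`: the four cases (fcc/hcp parent × fcc/hcp child) packaged over the walk invariant «`P_p = fcc ∧ X ∈ XF` or `P_p = hcp ∧ X ∈ XHax`»
  on the chart datum itself (real label `u ∈ P_p`, `f_p u = y k`; both scale windows), output `Y ∈ XF` (fcc child) or `Y ∈ XH` (hcp child: then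
  `XH_dichotomy` — re-anchor on `XHax` or kill); ★ `pair_cos_le` (two lines of one site at model cosine `1/3` read `≤ 1/3 + 246/10⁵`: the fcc hub of 23C)
  and its corollary ★ `side_kill_cos` (an hcp site seeing a carried SIDE member against its own axis `N_k`); `axis_unit_of_XHax` (§1: at an h-site the
  carried axis member IS `±N`).
[this file: 0 definitions; imports `…RunCutStarKernel` (23A-β) and `…RunCutBondLink` (23A-α); standard axioms]
-/

namespace Summit.AtomisticToContinuum.Crystallization.Theorems.OverbindingBudgetAffineRunCutBondCarry

open scoped InnerProductSpace
open Literature.Geometry.DiscreteGeometry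
open Summit.AtomisticToContinuum.Crystallization.Theorems.OverbindingBudgetAffineCompressedCutKernel (T3 tsq tdet tneg tscale fccL hcpL)
open Summit.AtomisticToContinuum.Crystallization.Theorems.OverbindingBudgetAffineCompressedCutCharts
  (mv mv_tneg mv_tscale norm_mv_eq_one_iff ListedBy Carries ChartDict carries_id_of_listedBy chartDict_of_exactDict listedBy_fcc listedBy_hcp)
open Summit.AtomisticToContinuum.Crystallization.Theorems.OverbindingBudgetAffineCompressedCutExact (ExactDict)
open Summit.AtomisticToContinuum.Crystallization.Theorems.OverbindingBudgetAffineCompressedCutEstablish (bond_exact nearestDist_pos_of_frame)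
open Summit.AtomisticToContinuum.Crystallization.Theorems.OverbindingBudgetAffineRunCutStarKernel
open Summit.AtomisticToContinuum.Crystallization.Theorems.OverbindingBudgetAffineRunCutBondLink
  (face_link quad_link face_link_record quad_link_record near_isometry_combo3 norm_face_lower norm_face_lower_scaled kappa_face chord_le
    inner_unit_perturb)

variable {N : ℕ}
local notation "E3" => EuclideanSpace ℝ (Fin 3)

/-! ## §1 Euclidean and model glue -/

/-- Normalising a positively scaled vector forgets the scale. [formal bookkeeping] -/
theorem unit_smul_pos {ν : ℝ} (hν : 0 < ν) (w : E3) : (‖ν • w‖⁻¹) • (ν • w) = (‖w‖⁻¹) • w := by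
  rw [norm_smul, Real.norm_of_nonneg hν.le, mul_inv, smul_smul]
  congr 1
  rw [mul_assoc, mul_comm ‖w‖⁻¹ ν, ← mul_assoc, inv_mul_cancel₀ hν.ne', one_mul]

/-- Normalising commutes with negation. [formal bookkeeping] -/
theorem unit_smul_neg (w : E3) : (‖-w‖⁻¹) • (-w) = -((‖w‖⁻¹) • w) := by
  rw [norm_neg, smul_neg]

/-- The model axis: `(1/3)·mv(12,12,12)` is the engine's `(√18)⁻¹·(4,4,4)`. [this file] -/
theorem third_mv_axis : (1 / 3 : ℝ) • mv (12, 12, 12) = (Real.sqrt 18)⁻¹ • intVec ![4, 4, 4] := by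
  rw [mv_axis_three, smul_smul]
  norm_num
  rfl

/-- The opposite axis member. [this file] -/
theorem third_mv_axis_neg : (1 / 3 : ℝ) • mv (-12, -12, -12) = -((Real.sqrt 18)⁻¹ • intVec ![4, 4, 4]) := by
  have h : ((-12 : ℤ), (-12 : ℤ), (-12 : ℤ)) = tneg (12, 12, 12) := by decide
  rw [h, mv_tneg, smul_neg, third_mv_axis]

/-- Two star members at `tdot = ±144` have model inner product `±8/9` at the `1/3` scale (model cosine `±1/3`: `tsq = 432`). [this file] -/
theorem model_inner_pair {Y Z : T3} (hd : tdot Y Z = 144 ∨ tdot Y Z = -144) :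
    ⟪(1 / 3 : ℝ) • mv Y, (1 / 3 : ℝ) • mv Z⟫_ℝ = 8 / 9 ∨ ⟪(1 / 3 : ℝ) • mv Y, (1 / 3 : ℝ) • mv Z⟫_ℝ = -(8 / 9) := by
  rw [real_inner_smul_left, real_inner_smul_right, inner_mv]
  rcases hd with h | h
  · left; rw [h]; norm_num
  · right; rw [h]; norm_num

/-- Through an exact isometry two star vectors (`‖·‖² = 8/3`) at inner product `±8/9` read cosine `±1/3` exactly. [this file] -/
theorem model_cos_third (Q : E3 →ₗᵢ[ℝ] E3) {a b : E3} (ha : ‖a‖ ^ 2 = 8 / 3) (hb : ‖b‖ ^ 2 = 8 / 3)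
    (hab : ⟪a, b⟫_ℝ = 8 / 9 ∨ ⟪a, b⟫_ℝ = -(8 / 9)) :
    |⟪(‖Q a‖⁻¹) • Q a, (‖Q b‖⁻¹) • Q b⟫_ℝ| = 1 / 3 := by
  rw [real_inner_smul_left, real_inner_smul_right, LinearIsometry.inner_map_map, LinearIsometry.norm_map, LinearIsometry.norm_map]
  have hna : ‖a‖ = Real.sqrt (8 / 3) := by rw [← ha, Real.sqrt_sq (norm_nonneg _)]
  have hnb : ‖b‖ = Real.sqrt (8 / 3) := by rw [← hb, Real.sqrt_sq (norm_nonneg _)]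
  have hs : (Real.sqrt (8 / 3))⁻¹ * (Real.sqrt (8 / 3))⁻¹ = 3 / 8 := by
    rw [← mul_inv, Real.mul_self_sqrt (by norm_num : (0 : ℝ) ≤ 8 / 3)]; norm_num
  rw [hna, hnb, ← mul_assoc, hs]
  rcases hab with h | h <;> rw [h] <;> norm_num

/-- ★ **SIDE COSINE THROUGH ONE FRAME.**  Two star vectors `a, b` (`‖·‖² = 8/3`) carried by a frame `A` with `‖A · − Q ·‖ ≤ 2/1000` on both and at exact
model cosine `1/3` (in absolute value) have `|cos(A a, A b)| ≤ 1/3 + 246/10⁵`: two chords `≤ (2/1000)/(16309/10⁴)` (`chord_le`, `norm_face_lower`) moved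
through `inner_unit_perturb`. [this file] -/
theorem side_cos_le {A : E3 →ₗ[ℝ] E3} {Q : E3 →ₗᵢ[ℝ] E3} {a b : E3} (hAa : ‖A a - Q a‖ ≤ 2 / 1000) (hAb : ‖A b - Q b‖ ≤ 2 / 1000)
    (ha : ‖a‖ ^ 2 = 8 / 3) (hb : ‖b‖ ^ 2 = 8 / 3) (hm : |⟪(‖Q a‖⁻¹) • Q a, (‖Q b‖⁻¹) • Q b⟫_ℝ| = 1 / 3) :
    |⟪(‖A a‖⁻¹) • A a, (‖A b‖⁻¹) • A b⟫_ℝ| ≤ 1 / 3 + 246 / 10 ^ 5 := by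
  have hL : (0 : ℝ) < 16309 / 10000 := by norm_num
  have hAa' : 16309 / 10000 ≤ ‖A a‖ := norm_face_lower hAa ha
  have hAb' : 16309 / 10000 ≤ ‖A b‖ := norm_face_lower hAb hb
  have hQa : 16309 / 10000 ≤ ‖Q a‖ := by rw [LinearIsometry.norm_map]; nlinarith [norm_nonneg a]
  have hQb : 16309 / 10000 ≤ ‖Q b‖ := by rw [LinearIsometry.norm_map]; nlinarith [norm_nonneg b]
  have ca := chord_le (A a) (Q a) hL hAa' hQa hAa
  have cb := chord_le (A b) (Q b) hL hAb' hQb hAb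
  have hQ0 : Q a ≠ 0 := by intro h; rw [h, norm_zero] at hQa; linarith
  have hA0 : A b ≠ 0 := by intro h; rw [h, norm_zero] at hAb'; linarith
  have hu1 : ‖(‖Q a‖⁻¹) • Q a‖ = 1 := by rw [norm_smul, norm_inv, norm_norm, inv_mul_cancel₀ (norm_ne_zero_iff.2 hQ0)]
  have hu2 : ‖(‖A b‖⁻¹) • A b‖ = 1 := by rw [norm_smul, norm_inv, norm_norm, inv_mul_cancel₀ (norm_ne_zero_iff.2 hA0)]
  have hp := inner_unit_perturb (a := (‖A a‖⁻¹) • A a) (b' := (‖Q b‖⁻¹) • Q b) hu1 hu2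
  have ht := abs_sub_abs_le_abs_sub ⟪(‖A a‖⁻¹) • A a, (‖A b‖⁻¹) • A b⟫_ℝ ⟪(‖Q a‖⁻¹) • Q a, (‖Q b‖⁻¹) • Q b⟫_ℝ
  have hn : (2 / 1000 : ℝ) / (16309 / 10000) + 2 / 1000 / (16309 / 10000) ≤ 246 / 10 ^ 5 := by norm_num
  linarith

/-- At the `1/3` scale every star member has `‖·‖² = 8/3`; through a frame `10⁻³`-close to an isometry on the pattern it is `2·10⁻³`-close, by its OWN-FACE
representation (three unit labels, coefficients `±2/3`). [this file] -/
theorem frame_star_close {A : E3 →ₗ[ℝ] E3} {Q : E3 →ₗᵢ[ℝ] E3} {P : Finset E3} {C : List T3} {X : T3}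
    (hA : ∀ v ∈ P, ‖A v - Q v‖ ≤ 1 / 1000) (hL : ListedBy P C) (ho : ownFaceB C X = true) :
    ‖A ((1 / 3 : ℝ) • mv X) - Q ((1 / 3 : ℝ) • mv X)‖ ≤ 2 / 1000 := by
  obtain ⟨c, u₁, u₂, u₃, hc, ⟨h₁, h₂, h₃⟩, -, hXe⟩ := ownFace_real_of_ownFaceB ho
  have h := near_isometry_combo3 (c₁ := c) (c₂ := c) (c₃ := c) (hA _ (hL.2 u₁ h₁)) (hA _ (hL.2 u₂ h₂)) (hA _ (hL.2 u₃ h₃))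
  have habs : (|c| + |c| + |c|) * (1 / 1000 : ℝ) = 2 / 1000 := by rw [hc]; norm_num
  rw [hXe]
  linarith

/-- The scaled lower norm `1.6309 ν ≤ ‖ν · A((1/3)mv X)‖` of a carried star member. [this file] -/
theorem star_norm_lower {A : E3 →ₗ[ℝ] E3} {Q : E3 →ₗᵢ[ℝ] E3} {P : Finset E3} {C : List T3} {X : T3} {ν : ℝ}
    (hA : ∀ v ∈ P, ‖A v - Q v‖ ≤ 1 / 1000) (hL : ListedBy P C) (ho : ownFaceB C X = true) (hsq : tsq X = 432) (hν : 0 ≤ ν) :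
    16309 / 10000 * ν ≤ ‖ν • A ((1 / 3 : ℝ) • mv X)‖ :=
  norm_face_lower_scaled hν (frame_star_close hA hL ho) (norm_third_mv_sq hsq)

/-- At an h-site a carried AXIS member `X ∈ XHax` reads `±N` (`N` = the engine's normalised frame axis). [this file] -/
theorem axis_unit_of_XHax {X : T3} (hX : X ∈ XHax) (A : E3 →ₗ[ℝ] E3) :
    ∃ σ : ℝ, (σ = 1 ∨ σ = -1) ∧ (‖A ((1 / 3 : ℝ) • mv X)‖⁻¹) • A ((1 / 3 : ℝ) • mv X) =
      σ • ((‖A ((Real.sqrt 18)⁻¹ • intVec ![4, 4, 4])‖⁻¹) • A ((Real.sqrt 18)⁻¹ • intVec ![4, 4, 4])) := by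
  simp only [XHax, List.mem_cons, List.not_mem_nil, or_false] at hX
  rcases hX with rfl | rfl
  · exact ⟨1, Or.inl rfl, by rw [third_mv_axis, one_smul]⟩
  · exact ⟨-1, Or.inr rfl, by rw [third_mv_axis_neg, map_neg, unit_smul_neg, neg_one_smul]⟩

/-- The axis members have own-face representations (from `ownFace_table` through `XHax ⊆ XH`). [this file] -/
theorem ownFace_XHax : (XHax.all fun X => ownFaceB hcpL X) = true :=
  List.all_eq_true.2 fun X hX => List.all_eq_true.1 ownFace_table.2 X (star_lists_shape.2.2.1 X hX)

section Atlas
/-! ONE chart datum on the ball `B(y j, ρ₁ ν_j)` (verbatim §2 of part 22A). -/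
variable {y : Fin N → E3} (hy : Function.Injective y) {j : Fin N} {ρ₁ : ℝ}
  {Ac : Fin N → (E3 →ₗ[ℝ] E3)} {Qc : Fin N → (E3 →ₗᵢ[ℝ] E3)} {Pc : Fin N → Finset E3} {fc : Fin N → E3 → E3}
  (hP : ∀ i, dist (y i) (y j) ≤ ρ₁ * nearestDist y j → Pc i = fccTwoShellPattern ∨ Pc i = hcpTwoShellPattern)
  (hA : ∀ i, dist (y i) (y j) ≤ ρ₁ * nearestDist y j → ∀ v ∈ Pc i, ‖Ac i v - Qc i v‖ ≤ 1 / 1000)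
  (hf : ∀ i, dist (y i) (y j) ≤ ρ₁ * nearestDist y j → ∀ v ∈ Pc i,
    fc i v ∈ Set.range y ∧ dist (fc i v) (y i + nearestDist y i • Ac i v) ≤ 1 / 10 ^ 4 * nearestDist y i)
  (hinj : ∀ i, dist (y i) (y j) ≤ ρ₁ * nearestDist y j → Set.InjOn (fc i) ↑(Pc i))
  (hex : ∀ i, dist (y i) (y j) ≤ ρ₁ * nearestDist y j → ∀ k : Fin N, k ≠ i →
    dist (y k) (y i) ≤ (3 / 2 + 1 / 450) * nearestDist y i → ∃ v ∈ Pc i, fc i v = y k)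

include hy hP hA hf hinj hex

/-! ## §2 The one-bond carry -/

/-- ★★ **BOND CARRY.**  Site `p` in the ball, its pattern listed by `Cp`, a first-shell label `x ∈ shellL Cp` registering `k` (in the ball, pattern listed by
`Ck ∈ {fccL, hcpL}`), a carried star member `X ∈ XP`; the kernel table `starKernelListB Cp (shellL Cp) Ck XP XS`, the representation table of `XP` at the
bonds of `Cp`, and the own-face tables of `XP`/`XS` hold (all by `decide` in `…RunCutStarKernel`).  Then `k ≠ p`, the scales compare as
`0.9967 ν_p ≤ ν_k ≤ 1.0011 ν_p`, and some child member `Y ∈ XS` (namely `R₁⁻¹ X`) is carried at chord cost `33/10⁵`: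
`‖unit(A_k((1/3)mv Y)) − unit(A_p((1/3)mv X))‖ ≤ 33/10⁵`. [this file] -/
theorem bond_carry {Cp Ck XP XS : List T3} (hK : starKernelListB Cp (shellL Cp) Ck XP XS = true)
    (hrep : ((shellL Cp).all fun x => XP.all fun X => repB Cp x X) = true)
    (hownP : (XP.all fun X => ownFaceB Cp X) = true) (hownS : (XS.all fun X => ownFaceB Ck X) = true)
    (hsqP : ∀ X ∈ XP, tsq X = 432) (hsqS : ∀ Y ∈ XS, tsq Y = 432) (hCk : Ck = fccL ∨ Ck = hcpL)
    {p k : Fin N} (hp : dist (y p) (y j) ≤ ρ₁ * nearestDist y j) (hk : dist (y k) (y j) ≤ ρ₁ * nearestDist y j)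
    (hLp : ListedBy (Pc p) Cp) (hLk : ListedBy (Pc k) Ck) {x X : T3} (hx : x ∈ shellL Cp) (hfx : fc p (mv x) = y k) (hX : X ∈ XP) :
    k ≠ p ∧ (9967 / 10000 * nearestDist y p ≤ nearestDist y k ∧ nearestDist y k ≤ 10011 / 10000 * nearestDist y p) ∧
      (9967 / 10000 * nearestDist y k ≤ nearestDist y p ∧ nearestDist y p ≤ 10011 / 10000 * nearestDist y k) ∧
      ∃ Y ∈ XS, ‖(‖Ac k ((1 / 3 : ℝ) • mv Y)‖⁻¹) • Ac k ((1 / 3 : ℝ) • mv Y) -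
        (‖Ac p ((1 / 3 : ℝ) • mv X)‖⁻¹) • Ac p ((1 / 3 : ℝ) • mv X)‖ ≤ 33 / 10 ^ 5 := by
  obtain ⟨hxC, hx18⟩ := mem_shellL.1 hx
  have hv : mv x ∈ Pc p := hLp.2 x hxC
  have hv1 : ‖mv x‖ = 1 := (norm_mv_eq_one_iff x).2 hx18
  obtain ⟨hkp, hlo, hhi, R₁, -, hD⟩ := bond_exact hy hP hA hf hinj hex hp hk hv hv1 hfx
  -- the reverse bond `k → p` along the back-pointer `w₀` (first shell: `R₁ w₀ = −mv x`) gives the reverse scale window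
  obtain ⟨w₀, hw₀, hfw₀, hRw₀⟩ := hD.1
  have hw₀1 : ‖w₀‖ = 1 := by rw [← R₁.norm_map w₀, hRw₀, norm_neg, hv1]
  obtain ⟨-, hlo', hhi', -⟩ := bond_exact hy hP hA hf hinj hex hk hp hw₀ hw₀1 hfw₀
  refine ⟨hkp, ⟨hlo, hhi⟩, ⟨hlo', hhi'⟩, ?_⟩
  have hCD := chartDict_of_exactDict LinearIsometry.id hD
  have hcar : Carries LinearIsometry.id (Pc p) Cp := carries_id_of_listedBy hLp
  obtain ⟨Y, hY, hG⟩ := star_step_one hK hx hCD hcar rfl hv1 hCk hLk X hX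
  have hR : R₁ (mv Y) = mv X := by simpa using hG
  refine ⟨Y, hY, ?_⟩
  have hνp : 0 < nearestDist y p := nearestDist_pos_of_frame hy (hP p hp) (fun v hv => (hf p hp v hv).1) (hinj p hp)
  have hνk : 0 < nearestDist y k := by linarith
  -- the two lower norms, from the own-face tables
  have lowP := star_norm_lower (hA p hp) hLp (List.all_eq_true.1 hownP X hX) (hsqP X hX) hνp.le
  have lowK := star_norm_lower (hA k hk) hLk (List.all_eq_true.1 hownS Y hY) (hsqS Y hY) hνk.le
  -- the link, from the representation table and the exact dictionary
  have hchord : ‖nearestDist y k • Ac k ((1 / 3 : ℝ) • mv Y) - nearestDist y p • Ac p ((1 / 3 : ℝ) • mv X)‖ ≤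
      1 / 10 ^ 4 * (2 * nearestDist y k + 10 / 3 * nearestDist y p) := by
    have hrx : repB Cp x X = true := List.all_eq_true.1 (List.all_eq_true.1 hrep x hx) X hX
    simp only [repB, Bool.or_eq_true] at hrx
    rcases hrx with hface | hquad
    · obtain ⟨c, va, vb, hc, ⟨hva, hvb⟩, ⟨⟨hnea, hlea⟩, ⟨hneb, hleb⟩⟩, hXe⟩ := face_real_of_faceRepB hface
      have hvaP : mv va ∈ Pc p := hLp.2 va hva
      have hvbP : mv vb ∈ Pc p := hLp.2 vb hvb
      obtain ⟨wa, hwa, hfwa, hRwa⟩ := hD.2 (mv va) hvaP hnea hlea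
      obtain ⟨wb, hwb, hfwb, hRwb⟩ := hD.2 (mv vb) hvbP hneb hleb
      have hYe : (1 / 3 : ℝ) • mv Y = c • w₀ + c • wa + c • wb := by
        apply R₁.injective
        simp only [map_add, map_smul, hR, hXe, hRw₀, hRwa, hRwb, smul_neg]
      have h := face_link (hf p hp) (hf k hk) hv hfx hvaP hvbP hw₀ hfw₀ hwa hfwa hwb hfwb c c c
      rw [← hYe, ← hXe] at h
      exact face_link_record hνp.le hc hc hc h
    · obtain ⟨ca, cb, cc, cd, va, vb, vc, vd, ⟨hca, hcb, hcc, hcd, hsum⟩, ⟨hva, hvb, hvc, hvd⟩,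
        ⟨⟨hnea, hlea⟩, ⟨hneb, hleb⟩, ⟨hnec, hlec⟩, ⟨hned, hled⟩⟩, hXe⟩ := quad_real_of_quadRepB hquad
      have hvaP : mv va ∈ Pc p := hLp.2 va hva
      have hvbP : mv vb ∈ Pc p := hLp.2 vb hvb
      have hvcP : mv vc ∈ Pc p := hLp.2 vc hvc
      have hvdP : mv vd ∈ Pc p := hLp.2 vd hvd
      obtain ⟨wa, hwa, hfwa, hRwa⟩ := hD.2 (mv va) hvaP hnea hlea
      obtain ⟨wb, hwb, hfwb, hRwb⟩ := hD.2 (mv vb) hvbP hneb hleb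
      obtain ⟨wc, hwc, hfwc, hRwc⟩ := hD.2 (mv vc) hvcP hnec hlec
      obtain ⟨wd, hwd, hfwd, hRwd⟩ := hD.2 (mv vd) hvdP hned hled
      have hYe : (1 / 3 : ℝ) • mv Y = ca • wa + cb • wb + cc • wc + cd • wd := by
        apply R₁.injective
        simp only [map_add, map_smul, hR, hXe, hRwa, hRwb, hRwc, hRwd]
      have h := quad_link (hf p hp) (hf k hk) hv hfx hvaP hvbP hvcP hvdP hwa hfwa hwb hfwb hwc hfwc hwd hfwd ca cb cc cd
      rw [← hYe, ← hXe] at h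
      have h2 := quad_link_record hca hcb hcc hcd hsum h
      have hνp0 : 0 ≤ nearestDist y p := hνp.le
      nlinarith [h2]
  have h := kappa_face hνp hlo hhi lowK lowP hchord
  rwa [unit_smul_pos hνk, unit_smul_pos hνp] at h

/-! ## §3 The walk interface: one step over the invariant, the kill reading -/

/-- ★ **CARRY STEP** over the walk invariant, stated on the chart datum itself: the current site `p` carries `X ∈ XF` if its pattern is fcc (any of its
four lines) and `X ∈ XHax` if hcp (its AXIS only); along ANY first-shell registration `u ∈ P_p`, `f_p u = y k` (`k` in the ball) the member is carried at
chord cost `33/10⁵` to some `Y ∈ XF` (fcc child) or `Y ∈ XH` (hcp child — then `XH_dichotomy`: `Y ∈ XHax`, re-anchor and walk on, or `Y` is a side member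
and `side_kill_cos` + the engine kill the pair).  Both scale windows of the bond are recorded.  Tables `sk_ff`/`sk_fh`/`sk_hf`/`sk_hh`, `rep_table`,
`ownFace_table`, `star_lists_shape` of `…RunCutStarKernel`; labels through `listedBy_fcc`/`listedBy_hcp`. [this file] -/
theorem carry_step {p k : Fin N} (hp : dist (y p) (y j) ≤ ρ₁ * nearestDist y j) (hk : dist (y k) (y j) ≤ ρ₁ * nearestDist y j) {X : T3}
    (hinv : (Pc p = fccTwoShellPattern ∧ X ∈ XF) ∨ (Pc p = hcpTwoShellPattern ∧ X ∈ XHax))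
    {u : E3} (hu : u ∈ Pc p) (hu1 : ‖u‖ = 1) (hfu : fc p u = y k) :
    k ≠ p ∧ (9967 / 10000 * nearestDist y p ≤ nearestDist y k ∧ nearestDist y k ≤ 10011 / 10000 * nearestDist y p) ∧
      (9967 / 10000 * nearestDist y k ≤ nearestDist y p ∧ nearestDist y p ≤ 10011 / 10000 * nearestDist y k) ∧
      ∃ Y : T3, ((Pc k = fccTwoShellPattern ∧ Y ∈ XF) ∨ (Pc k = hcpTwoShellPattern ∧ Y ∈ XH)) ∧
        ‖(‖Ac k ((1 / 3 : ℝ) • mv Y)‖⁻¹) • Ac k ((1 / 3 : ℝ) • mv Y) -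
          (‖Ac p ((1 / 3 : ℝ) • mv X)‖⁻¹) • Ac p ((1 / 3 : ℝ) • mv X)‖ ≤ 33 / 10 ^ 5 := by
  obtain ⟨sF, sH, sAH, sA⟩ := star_lists_shape
  have hLf : ∀ {i : Fin N}, Pc i = fccTwoShellPattern → ListedBy (Pc i) fccL := fun h => by rw [h]; exact listedBy_fcc
  have hLh : ∀ {i : Fin N}, Pc i = hcpTwoShellPattern → ListedBy (Pc i) hcpL := fun h => by rw [h]; exact listedBy_hcp
  -- the current site's list, carried list and tables (fcc: any line; hcp: the axis)
  obtain ⟨Cp, XP, hLp, hX, hrep, hownP, hsqP, hKf, hKh⟩ : ∃ Cp XP : List T3, ListedBy (Pc p) Cp ∧ X ∈ XP ∧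
      ((shellL Cp).all fun x => XP.all fun X => repB Cp x X) = true ∧ (XP.all fun X => ownFaceB Cp X) = true ∧ (∀ X ∈ XP, tsq X = 432) ∧
      starKernelListB Cp (shellL Cp) fccL XP XF = true ∧ starKernelListB Cp (shellL Cp) hcpL XP XH = true := by
    rcases hinv with ⟨hPp, hX⟩ | ⟨hPp, hX⟩
    · exact ⟨fccL, XF, hLf hPp, hX, rep_table.1, ownFace_table.1, sF, sk_ff, sk_fh⟩
    · exact ⟨hcpL, XHax, hLh hPp, hX, rep_table.2, ownFace_XHax, sA, sk_hf, sk_hh⟩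
  -- the child's list and star (fcc: `XF`; hcp: the full `XH`)
  obtain ⟨Ck, XS, hLk, hCk, hK, hownS, hsqS, hXS⟩ : ∃ Ck XS : List T3, ListedBy (Pc k) Ck ∧ (Ck = fccL ∨ Ck = hcpL) ∧
      starKernelListB Cp (shellL Cp) Ck XP XS = true ∧ (XS.all fun X => ownFaceB Ck X) = true ∧ (∀ Y ∈ XS, tsq Y = 432) ∧
      ∀ Y ∈ XS, (Pc k = fccTwoShellPattern ∧ Y ∈ XF) ∨ (Pc k = hcpTwoShellPattern ∧ Y ∈ XH) := by
    rcases hP k hk with hPk | hPk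
    · exact ⟨fccL, XF, hLf hPk, Or.inl rfl, hKf, ownFace_table.1, sF, fun Y hY => Or.inl ⟨hPk, hY⟩⟩
    · exact ⟨hcpL, XH, hLh hPk, Or.inr rfl, hKh, ownFace_table.2, sH, fun Y hY => Or.inr ⟨hPk, hY⟩⟩
  obtain ⟨x, hxC, rfl⟩ := hLp.1 u hu
  have hx : x ∈ shellL Cp := mem_shellL.2 ⟨hxC, (norm_mv_eq_one_iff x).1 hu1⟩
  obtain ⟨h1, h2, h3, Y, hY, hb⟩ := bond_carry hy hP hA hf hinj hex hK hrep hownP hownS hsqP hsqS hCk hp hk hLp hLk hx hfu hX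
  exact ⟨h1, h2, h3, Y, hXS Y hY, hb⟩

omit hy hP hf hinj hex in
/-- ★ **TWO LINES THROUGH ONE FRAME.**  At a site `k` in the ball listed by `C`, two own-face-represented star members `X, X′` at model cosine `±1/3`
(`tdot X X′ = ±144`) read `|cos| ≤ 1/3 + 246/10⁵` physically (the fcc hub's different-lines case of part 23C, and the h-site kill below). [this file] -/
theorem pair_cos_le {k : Fin N} (hk : dist (y k) (y j) ≤ ρ₁ * nearestDist y j) {C : List T3} (hLk : ListedBy (Pc k) C) {X X' : T3}
    (hoX : ownFaceB C X = true) (hoX' : ownFaceB C X' = true) (hsq : tsq X = 432) (hsq' : tsq X' = 432)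
    (hd : tdot X X' = 144 ∨ tdot X X' = -144) :
    |⟪(‖Ac k ((1 / 3 : ℝ) • mv X)‖⁻¹) • Ac k ((1 / 3 : ℝ) • mv X),
        (‖Ac k ((1 / 3 : ℝ) • mv X')‖⁻¹) • Ac k ((1 / 3 : ℝ) • mv X')⟫_ℝ| ≤ 1 / 3 + 246 / 10 ^ 5 :=
  have ha := norm_third_mv_sq hsq
  have hb := norm_third_mv_sq hsq'
  side_cos_le (frame_star_close (hA k hk) hLk hoX) (frame_star_close (hA k hk) hLk hoX') ha hb
    (model_cos_third (Qc k) ha hb (model_inner_pair hd))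

omit hy hP hf hinj hex in
/-- ★ **SIDE-MEMBER KILL READING.**  At an hcp site `k` in the ball, a carried SIDE member `Y ∈ XH` (`tdot Y axis = ±144`) makes physical
`|cos| ≤ 1/3 + 246/10⁵` with the site's own frame axis `N_k = unit(A_k((√18)⁻¹(4,4,4)))` — the engine's crossing hypothesis `hc` up to the leg's
accumulated chord. [this file] -/
theorem side_kill_cos {k : Fin N} (hk : dist (y k) (y j) ≤ ρ₁ * nearestDist y j) (hPk : Pc k = hcpTwoShellPattern) {Y : T3} (hY : Y ∈ XH)
    (hside : tdot Y (12, 12, 12) = 144 ∨ tdot Y (12, 12, 12) = -144) :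
    |⟪(‖Ac k ((1 / 3 : ℝ) • mv Y)‖⁻¹) • Ac k ((1 / 3 : ℝ) • mv Y),
        (‖Ac k ((Real.sqrt 18)⁻¹ • intVec ![4, 4, 4])‖⁻¹) • Ac k ((Real.sqrt 18)⁻¹ • intVec ![4, 4, 4])⟫_ℝ| ≤ 1 / 3 + 246 / 10 ^ 5 := by
  have hax : ((12 : ℤ), (12 : ℤ), (12 : ℤ)) ∈ XH := by decide
  have hLk : ListedBy (Pc k) hcpL := by rw [hPk]; exact listedBy_hcp
  rw [← third_mv_axis]
  exact pair_cos_le hA hk hLk (List.all_eq_true.1 ownFace_table.2 Y hY) (List.all_eq_true.1 ownFace_table.2 _ hax)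
    (star_lists_shape.2.1 Y hY) (star_lists_shape.2.1 _ hax) hside

end Atlas

end Summit.AtomisticToContinuum.Crystallization.Theorems.OverbindingBudgetAffineRunCutBondCarry
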